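import Literature.Probability.RandomPlanarGeometry.HexSAWSurfaceWallRenewalEighthCensusIdentity
import Literature.Probability.RandomPlanarGeometry.HexSAWSurfaceWallRenewalCensusEightA
import Literature.Probability.RandomPlanarGeometry.HexSAWSurfaceWallRenewalCensusEightB2
import Literature.Probability.RandomPlanarGeometry.HexSAWSurfaceWallRenewalSixStepRigid
import HarnessLib

/-!
# The eighth-order coefficient of `β(y)²` is exactly eighteen:
# `y⁷ (β(y)² − y − 1/y − 1/y² − 2/y³ − 4/y⁴ − 6/y⁵ − 12/y⁶) → 18`

`β(y) = wallRate y` is the exponential growth rate of wall bridges of self-avoiding walks on the brick-wall (hexagonal) lattice along a zigzag wall with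
contact fugacity `y`.  «EIGHTH-CENSUS-IDENTITY» (`HexSAWSurfaceWallRenewalEighthCensusIdentity`) proved that the eighth coefficient of the strong-adsorption
expansion exists and equals `N₉,₁ + N₁₀,₂ + N₁₁,₃ + N₁₂,₄ − 213`, the four class numbers of the diagonal `s − v = 8` of the wall-renewal census being symbolic.
This module substitutes the kernel-certified values — `N₉,₁ = 98`, `N₁₀,₂ = 99` («CENSUS-EIGHT-A»), `N₁₁,₃ = 33` («CENSUS-EIGHT-B2»), and `N₁₂,₄ = 1` from
a-idea-1 g35's «SIX-STEP-RIGIDITY» (`card_filter_six_mul_visits_eq : #{ω ∈ ipwb n : 6·visits = n} = [6 ∣ n]`, at `n = 24`: `visits = 4 ⟺ 6·visits = 24`):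

  ★★★ `tendsto_pow_seven_mul_wallRate_sq_sub : y⁷ (β(y)² − y − 1/y − 1/y² − 2/y³ − 4/y⁴ − 6/y⁵ − 12/y⁶) → 18` (`y → ∞`),

i.e. **`β(y)² = y + 1/y + 1/y² + 2/y³ + 4/y⁴ + 6/y⁵ + 12/y⁶ + 18/y⁷ + o(y⁻⁷)`** (`isLittleO_wallRate_sq_sub_eighth`, `eventually_eighth_order_window`,
`tendsto_pow_seven_mul_wallRate_sq_sub_unique`) — the lane's prediction `a₇ = 18` of the 20th «Question for Ben Adlam» (PLAN am.50; a-idea-1 g30–g34's fibre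
programme `E₈ = 75 ⇒ a₆ = 12, a₇ = 18, a₈ = 15`) is a THEOREM.  Also `card_fourVisit_ipwb_twentyfour_eq_one : N₁₂,₄ = 1` in the census' `visits = 4` form.

HONEST LABEL.  LANE THEOREM, DERIVED (one-line assembly of the four landed inputs); NEW IN WRITING (modest): the coefficient is computed in this lane, print has
`β ∼ √y` only ([BeatonBousquetMelouDeGierDuminilCopinGuttmann2014, §3.1, Proposition 5, p. 10]) and the renewal structure ([MadrasSlade1993, §4.2], [Kesten1963SAW, §4]).
NOT CLAIMED: `a₈` (needs the diagonal `s − v = 9`), any rate, `m₈ / V₈ / d₈` (the order-eight pure forms — next car), anything for `y ≤ μ³`.  No definitions.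
-/

namespace Literature.Probability.RandomPlanarGeometry.SAW.HexBW.Wall

open Finset Filter Function
open Literature.Probability.LatticeModels
open _root_.Topology Asymptotics

variable {y : ℝ}

/-- [folklore] Relabel the limit of a `Tendsto` by an equal constant. -/
private theorem tendsto_of_tendsto_of_eq_ex {f : ℝ → ℝ} {L c : ℝ} (h : Tendsto f atTop (𝓝 L)) (e : L = c) :
    Tendsto f atTop (𝓝 c) := e ▸ h

open Classical in
/-- ★★ **`N₁₂,₄ = 1`** in the census' form: exactly one irreducible positive wall bridge of length twenty-four visits the surface four times (the hook `H₄`) —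
from «SIX-STEP-RIGIDITY»'s `card_filter_six_mul_visits_eq` (`visits = 4 ⟺ 6·visits = 24`). [cite: MadrasSlade1993, Section 4.2, Definition 4.2.1, (4.2.2)] [cite: Kesten1963SAW, Section 4] -/
theorem card_fourVisit_ipwb_twentyfour_eq_one {m : ℕ} (hm : m = 24) : #((ipwb m).filter fun ω => visits m ω = 4) = 1 := by
  have hc : ((ipwb m).filter fun ω => visits m ω = 4) = (ipwb m).filter fun ω => 6 * visits m ω = m := by
    refine Finset.filter_congr fun ω _ => ?_
    subst hm
    omega
  rw [hc, card_filter_six_mul_visits_eq (by omega), if_pos (by subst hm; norm_num)]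

/-- ★★★ **THE EIGHTH-ORDER COEFFICIENT OF `β(y)²` IS EXACTLY EIGHTEEN:**
`y⁷ (β(y)² − y − 1/y − 1/y² − 2/y³ − 4/y⁴ − 6/y⁵ − 12/y⁶) → 18` as `y → ∞` — the census identity with `N₉,₁ = 98`, `N₁₀,₂ = 99`, `N₁₁,₃ = 33`, `N₁₂,₄ = 1`:
`98 + 99 + 33 + 1 − 213 = 18`. [cite: BeatonBousquetMelouDeGierDuminilCopinGuttmann2014, Section 3.1, Proposition 5 (arXiv v5 p. 9); p. 10] [cite: Kesten1963SAW, Section 4] [cite: MadrasSlade1993, Section 4.2, (4.2.4), Theorem 4.2.2 (pp. 91–92)] -/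
theorem tendsto_pow_seven_mul_wallRate_sq_sub :
    Tendsto (fun y : ℝ => y ^ 7 * (wallRate y ^ 2 - y - 1 / y - 1 / y ^ 2 - 2 / y ^ 3 - 4 / y ^ 4 - 6 / y ^ 5 - 12 / y ^ 6)) atTop (𝓝 18) := by
  classical
  have h := tendsto_pow_seven_mul_wallRate_sq_sub_census (m₁ := 18) (m₂ := 20) (m₃ := 22) (m₄ := 24) rfl rfl rfl rfl
  rw [card_oneVisit_ipwb_eighteen_eq_ninetyEight rfl, card_twoVisit_ipwb_twenty_eq_ninetyNine rfl, card_threeVisit_ipwb_twentytwo_eq_thirtyThree rfl,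
    card_fourVisit_ipwb_twentyfour_eq_one rfl] at h
  exact tendsto_of_tendsto_of_eq_ex h (by norm_num)

/-- ★★★ The same in Landau form: `β(y)² − (y + 1/y + 1/y² + 2/y³ + 4/y⁴ + 6/y⁵ + 12/y⁶ + 18/y⁷) = o(y⁻⁷)` as `y → ∞`.
[cite: BeatonBousquetMelouDeGierDuminilCopinGuttmann2014, Section 3.1, Proposition 5 (arXiv v5 p. 9)] -/
theorem isLittleO_wallRate_sq_sub_eighth :
    (fun y : ℝ => wallRate y ^ 2 - (y + 1 / y + 1 / y ^ 2 + 2 / y ^ 3 + 4 / y ^ 4 + 6 / y ^ 5 + 12 / y ^ 6 + 18 / y ^ 7)) =o[atTop]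
      fun y : ℝ => 1 / y ^ 7 := by
  have h0 : Tendsto (fun y : ℝ => y ^ 7 * (wallRate y ^ 2 - y - 1 / y - 1 / y ^ 2 - 2 / y ^ 3 - 4 / y ^ 4 - 6 / y ^ 5 - 12 / y ^ 6) - 18)
      atTop (𝓝 0) := by
    simpa using tendsto_pow_seven_mul_wallRate_sq_sub.sub_const 18
  have h1 : (fun y : ℝ => y ^ 7 * (wallRate y ^ 2 - y - 1 / y - 1 / y ^ 2 - 2 / y ^ 3 - 4 / y ^ 4 - 6 / y ^ 5 - 12 / y ^ 6) - 18) =o[atTop]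
      fun _ : ℝ => (1 : ℝ) := (isLittleO_one_iff ℝ).2 h0
  have h2 := h1.mul_isBigO (isBigO_refl (fun y : ℝ => 1 / y ^ 7) atTop)
  refine (h2.congr' ?_ ?_)
  · filter_upwards [eventually_gt_atTop (0 : ℝ)] with y hy
    field_simp
    ring
  · exact Eventually.of_forall fun y => by simp

/-- ★★ Two-sided eventual form: for every `δ > 0`, eventually
`y + 1/y + 1/y² + 2/y³ + 4/y⁴ + 6/y⁵ + 12/y⁶ + (18 − δ)/y⁷ ≤ β(y)² ≤ y + 1/y + 1/y² + 2/y³ + 4/y⁴ + 6/y⁵ + 12/y⁶ + (18 + δ)/y⁷`.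
[cite: BeatonBousquetMelouDeGierDuminilCopinGuttmann2014, Section 3.1, Proposition 5 (arXiv v5 p. 9)] -/
theorem eventually_eighth_order_window {δ : ℝ} (hδ : 0 < δ) :
    ∀ᶠ y : ℝ in atTop, y + 1 / y + 1 / y ^ 2 + 2 / y ^ 3 + 4 / y ^ 4 + 6 / y ^ 5 + 12 / y ^ 6 + (18 - δ) / y ^ 7 ≤ wallRate y ^ 2 ∧
      wallRate y ^ 2 ≤ y + 1 / y + 1 / y ^ 2 + 2 / y ^ 3 + 4 / y ^ 4 + 6 / y ^ 5 + 12 / y ^ 6 + (18 + δ) / y ^ 7 := by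
  have h := tendsto_pow_seven_mul_wallRate_sq_sub
  have hhi := h.eventually (eventually_lt_nhds (show (18 : ℝ) < 18 + δ by linarith))
  filter_upwards [eventually_eighth_order_floor hδ, hhi, eventually_gt_atTop (0 : ℝ)] with y h1 h2 hy
  refine ⟨h1, ?_⟩
  have hy7 : 0 < y ^ 7 := pow_pos hy 7
  have e2 : wallRate y ^ 2 = (y + 1 / y + 1 / y ^ 2 + 2 / y ^ 3 + 4 / y ^ 4 + 6 / y ^ 5 + 12 / y ^ 6) +
      (y ^ 7 * (wallRate y ^ 2 - y - 1 / y - 1 / y ^ 2 - 2 / y ^ 3 - 4 / y ^ 4 - 6 / y ^ 5 - 12 / y ^ 6)) / y ^ 7 := by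
    field_simp
    ring
  have e : y + 1 / y + 1 / y ^ 2 + 2 / y ^ 3 + 4 / y ^ 4 + 6 / y ^ 5 + 12 / y ^ 6 + (18 + δ) / y ^ 7 =
      (y + 1 / y + 1 / y ^ 2 + 2 / y ^ 3 + 4 / y ^ 4 + 6 / y ^ 5 + 12 / y ^ 6) + (18 + δ) / y ^ 7 := by ring
  rw [e, e2]
  gcongr

/-- ★ Uniqueness form: any limit of `y⁷ (β(y)² − y − 1/y − 1/y² − 2/y³ − 4/y⁴ − 6/y⁵ − 12/y⁶)` equals `18`. [cite: MadrasSlade1993, Section 4.2, Theorem 4.2.2 (pp. 91–92)] -/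
theorem tendsto_pow_seven_mul_wallRate_sq_sub_unique {L : ℝ}
    (h : Tendsto (fun y : ℝ => y ^ 7 * (wallRate y ^ 2 - y - 1 / y - 1 / y ^ 2 - 2 / y ^ 3 - 4 / y ^ 4 - 6 / y ^ 5 - 12 / y ^ 6)) atTop (𝓝 L)) :
    L = 18 :=
  tendsto_nhds_unique h tendsto_pow_seven_mul_wallRate_sq_sub

end Literature.Probability.RandomPlanarGeometry.SAW.HexBW.Wall
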